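import Summits.HubbardSuperconductivity.HubbardLadder.PairCorrWindowUniformTargets
import Summits.HubbardSuperconductivity.HubbardLadder.R3R4SumRule
import Literature.MathematicalPhysics.QuantumLattice.PairFieldYangCeiling
import HarnessLib

/-!
# Rungs R3/R4 — uniform ceilings, part 3: ONE translation-invariant certificate for a LIST objective

HONEST FRAMING (page 1): ladder R1–R4 with certified numbers; no claim on H/H₀. Certificate DATA
types and their soundness only; no certificate has been computed. Third part of the split of
`PairFieldCeilingUniform.lean` (§7a): `PairListCertTT'` = a translation-invariant window certificate
for the list objective `Σ_i λ_i · Δ_0† Δ_{r_i}` in the `t–t'` model (field layout of `PairWindowCertTT'`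
verbatim), its soundness `bound_le` / `bound_le_sum_avgPairCorr` on every torus `L ≥ 3` the windows fit and
EVERY sector ground-state vector (from the general TI window theorem by linearity), the TL limit of its
bound (`abs_bound_sub_q_le`, `bound_ge_eventually`), and `PairListCertTT'.ofSingle` (a single-row upper
certificate at `r = 0` IS the list certificate of the block `S = {0}`). Block consumers
(`UpperBlockListCertTT'`, `R4CeilingListCert`, the edge to H⁻) are in `PairFieldCeilingListBlocks.lean`.
-/

namespace Summit.HubbardSuperconductivity.HubbardLadder

open Matrix Finset Filter Literature.Probability.LatticeModels
  Literature.MathematicalPhysics.QuantumLattice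
open Literature.MathematicalPhysics.QuantumLattice.ThermodynamicLimit
open Literature.MathematicalPhysics.QuantumManyBody.StateRelaxation
open scoped ComplexOrder Topology

noncomputable section

/-- Archimedean helper: `M / L² < g` on all large sides (private copy of the helper in
`PairFieldCeilingUniformRows.lean`; private declarations do not cross module boundaries). [folklore] -/
private theorem exists_forall_div_sq_lt' (M : ℝ) {g : ℝ} (hg : 0 < g) :
    ∃ L₀ : ℕ, ∀ L : ℕ, L₀ ≤ L → M / (L : ℝ) ^ 2 < g := by
  obtain ⟨L₀, hL₀⟩ := exists_nat_gt (M / g)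
  refine ⟨L₀ + 1, fun L hL => ?_⟩
  have hLr : (L₀ : ℝ) + 1 ≤ L := by exact_mod_cast hL
  have hL0 : (0 : ℝ) ≤ L₀ := Nat.cast_nonneg L₀
  have hL1 : (1 : ℝ) ≤ L := by linarith
  have hL2 : (0 : ℝ) < (L : ℝ) ^ 2 := by nlinarith
  rw [div_lt_iff₀ hL2]
  rw [div_lt_iff₀ hg] at hL₀
  nlinarith [mul_le_mul_of_nonneg_right (show (L : ℝ) ≤ (L : ℝ) ^ 2 by nlinarith) hg.le]

/-! ## §7 ONE certificate per block: LIST objectives (the engines' `pair_dd` LIST grammar) -/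

/-- **A translation-invariant window certificate for a LIST objective** `Σ_i λ_i · Δ_0† Δ_{r_i}`
(`d`-wave form factor; finitely many displacements `r_i` with real coefficients `λ_i`) in the `t–t'`
Hubbard model `(t, t', U)`: the field layout of `PairWindowCertTT'` verbatim (windows `Λ ⊆ Λ' ⊆ ℤ²`,
energy constraint `κ (u·1 − E^{tt'}_Φ)` with `κ ≥ 0`, density multipliers `μ_σ (n_{0σ} − ν)`, SOS /
Gram part, equation-of-motion multipliers, TRANSLATION identification terms, charged words,
anti-Hermitian parts, residual words, the constant `c`, the identity `hcert`), except that the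
objective is the finite combination `Σ_i λ_i W(r_i)` of window pair correlators — ONE certificate for
a whole block sum instead of one per displacement. Certificate data only; nothing about the Hubbard
ground state is assumed. [cite: WangEtAl2024, §III] [cite: Han2020Bootstrap, §3] -/
structure PairListCertTT' (t t' U : ℝ) (n : ℕ) (lam : Fin n → ℝ) (r : Fin n → Site 2) where
  /-- inner window `Λ` and outer window `Λ'` -/
  Λ : Finset (Site 2)
  Λ' : Finset (Site 2)
  hΛ : Λ ⊆ Λ'
  h8 : thicken Λ 1 ⊆ Λ'
  h0 : thicken ({0} : Finset (Site 2)) 1 ⊆ Λ'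
  hz : (0 : Site 2) ∈ Λ'
  /-- the objective's pair regions lie in the window -/
  hp0 : pairRegion (insert 0 unitSteps) 0 ⊆ Λ'
  hpr : ∀ i, pairRegion (insert 0 unitSteps) (r i) ⊆ Λ'
  /-- energy constraint: weight `κ ≥ 0` and ceiling `u` -/
  κ : ℝ
  κ_nonneg : 0 ≤ κ
  u : ℝ
  /-- density multipliers `μ_σ (n_{0σ} − ν·1)` -/
  μ : Fin 2 → ℝ
  ν : ℝ
  /-- the SOS / Gram part -/
  m : ℕ
  Λm : Matrix (Fin m) (Fin m) ℂ
  hΛm : Λm.PosSemidef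
  O : Fin m → FermionOp Λ'
  /-- equation-of-motion multipliers `[H^{tt'}_{Λ'}, B_k]` -/
  k₁ : ℕ
  B : Fin k₁ → FermionOp Λ
  /-- translation identification terms `Γ(τ_w) Y − Y` -/
  k₂ : ℕ
  wv : Fin k₂ → Site 2
  hsh : ∀ l, d4ShiftSet 1 (wv l) Λ ⊆ Λ'
  Y : Fin k₂ → FermionOp Λ
  /-- charge / spin-charge ladder words -/
  k₃ : ℕ
  b : Fin k₃ → ℂ
  cw : Fin k₃ → List (Orb (PolySite Λ') × Bool)
  hcw : ∀ j, ladderCharge (cw j) ≠ 0 ∨ ladderSpinCharge (cw j) ≠ 0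
  /-- anti-Hermitian parts -/
  k₄ : ℕ
  dc : Fin k₄ → ℝ
  V : Fin k₄ → FermionOp Λ'
  /-- residual words with their coefficients, and the constant `c` -/
  k₅ : ℕ
  a : Fin k₅ → ℂ
  word : Fin k₅ → List (Orb (PolySite Λ') × Bool)
  c : ℝ
  /-- the certificate identity in the CAR algebra of the window -/
  hcert : ∑ i, ((lam i : ℝ) : ℂ) • windowPairCorrObs (insert 0 unitSteps) dWaveFormFactor (r i) hp0 (hpr i) -
        (c : ℂ) • (1 : FermionOp Λ') -
        ∑ σ : Fin 2, ((μ σ : ℝ) : ℂ) • (nAt 0 hz σ - ((ν : ℝ) : ℂ) • (1 : FermionOp Λ')) -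
        ((κ : ℝ) : ℂ) • (((u : ℝ) : ℂ) • (1 : FermionOp Λ') -
          fermionEmbed (PolySite.incl h0) ((hubbardTTPrimeFermionInteraction t t' U).meanEnergyObs 1)) =
      gramForm Λm O +
        (∑ k ∈ univ, ((hubbardTTPrimeFermionInteraction t t' U).localHamiltonian Λ' * fermionEmbed (PolySite.incl hΛ) (B k) -
            fermionEmbed (PolySite.incl hΛ) (B k) * (hubbardTTPrimeFermionInteraction t t' U).localHamiltonian Λ') +
          ∑ l ∈ univ, (fermionEmbed (PolySite.incl (hsh l)) (fermionEmbed (PolySite.d4Emb 1 (wv l) Λ) (Y l)) -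
            fermionEmbed (PolySite.incl hΛ) (Y l)) +
          ∑ j ∈ univ, b j • ladderWord (cw j)) +
        (∑ m' ∈ univ, ((dc m' : ℝ) : ℂ) • ((V m')ᴴ - V m') + ∑ k ∈ univ, a k • ladderWord (word k))

namespace PairListCertTT'

variable {t t' U : ℝ} {n : ℕ} {lam : Fin n → ℝ} {r : Fin n → Site 2}

/-- The constant net of the residual mass: `q = c − Σₖ ‖aₖ‖`. [cite: Han2020Bootstrap, §3] -/
def q (C : PairListCertTT' t t' U n lam r) : ℝ := C.c - ∑ k, ‖C.a k‖

/-- The certified number on the torus of side `L` at `nh` pairs: `q + (Σ_σ μ_σ)(nh/L² − ν)`.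
[cite: WangEtAl2024, §III] -/
def bound (C : PairListCertTT' t t' U n lam r) (L nh : ℕ) : ℝ :=
  C.q + (∑ σ : Fin 2, C.μ σ) * ((nh : ℝ) / (L : ℝ) ^ 2 - C.ν)

/-- **Soundness, uniform in `L`.** For every `L ≥ 3` into which the window fits, every `nh ≤ |𝕋_L|`
with `groundEnergy (hubbardTorusTT' L t t' U) (2 nh) / L² ≤ u`, and EVERY unit ground state `ψ` of
the sector `(2 nh, S^z = 0)`:
`bound L nh ≤ Σ_i λ_i · Re ⟨ψ, O_{r_i} ψ⟩ / L²` (`O_r = pairCorrOp L r = Σ_x Δ_x† Δ_{x+r}`).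
(Literature `re_orbitState_ge_of_window_certificate_d4_TT'_groundState` with the trivial point group
and the list observable; linearity of `fermionEmbed` and of the orbit state;
`fermionEmbed_toTorusEmb_windowPairCorrObs_localPair`, `re_orbitState_localPair_corr_eq_div` term by
term.) [cite: WangEtAl2024, §III] -/
theorem bound_le (C : PairListCertTT' t t' U n lam r) {L : ℕ} [NeZero L] (hL : 3 ≤ L)
    (hInj : Set.InjOn (Torus.proj (d := 2) L) ↑(thicken C.Λ' 1)) {nh : ℕ}
    (hn : nh ≤ Fintype.card (FermionTorus 2 L))
    (hu : groundEnergy (hubbardTorusTT' L t t' U) (2 * nh) / (L : ℝ) ^ 2 ≤ C.u)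
    {ψ : Fock (Orb (FermionTorus 2 L))} (hGS : IsGroundStateInSector (hubbardTorusTT' L t t' U) (2 * nh) 0 ψ)
    (hψ1 : star ψ ⬝ᵥ ψ = 1) :
    C.bound L nh ≤ ∑ i, lam i * ((star ψ ⬝ᵥ pairCorrOp L (r i) *ᵥ ψ).re / (L : ℝ) ^ 2) := by
  have hInj' : Set.InjOn (Torus.proj (d := 2) L) ↑C.Λ' :=
    hInj.mono (by exact_mod_cast subset_thicken C.Λ' 1)
  have h := re_orbitState_ge_of_window_certificate_d4_TT'_groundState t t' U hL hn C.hΛ C.h8 C.h0 C.hz hInj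
    hInj' (S := ({1} : Finset (DihedralGroup 4))) (Finset.mem_singleton_self _)
    (fun a ha b hb => by
      rw [Finset.mem_singleton] at ha hb ⊢
      rw [ha, hb, one_mul])
    hGS hψ1 C.κ_nonneg hu
    (∑ i, ((lam i : ℝ) : ℂ) • windowPairCorrObs (insert 0 unitSteps) dWaveFormFactor (r i) C.hp0 (C.hpr i))
    C.μ C.ν C.hΛm C.O univ C.B univ (fun _ => 1) (fun _ _ => Finset.mem_singleton_self _) C.wv C.hsh C.Y
    univ C.b C.cw (fun j _ => C.hcw j) univ C.dc C.V univ C.a C.word C.hcert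
  rw [fermionEmbed_sum, map_sum, Complex.re_sum] at h
  simp only [fermionEmbed_smul, LinearMap.map_smul, fermionEmbed_toTorusEmb_windowPairCorrObs_localPair,
    smul_eq_mul, Complex.re_ofReal_mul, re_orbitState_localPair_corr_eq_div] at h
  rw [bound, q]
  simpa only [pairCorrOp] using h

/-- Soundness restated on `avgPairCorr`: `bound (m+1) nh ≤ Σ_i λ_i · P̄_d(m+1, r_i; ψ)`.
[cite: QinEtAl2020, §II eqs. (2)–(4)] -/
theorem bound_le_sum_avgPairCorr (C : PairListCertTT' t t' U n lam r) (m : ℕ) (hL : 3 ≤ m + 1)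
    (hInj : Set.InjOn (Torus.proj (d := 2) (m + 1)) ↑(thicken C.Λ' 1)) {nh : ℕ}
    (hn : nh ≤ Fintype.card (FermionTorus 2 (m + 1)))
    (hu : groundEnergy (hubbardTorusTT' (m + 1) t t' U) (2 * nh) / ((m + 1 : ℕ) : ℝ) ^ 2 ≤ C.u)
    {ψ : Fock (Orb (FermionTorus 2 (m + 1)))}
    (hGS : IsGroundStateInSector (hubbardTorusTT' (m + 1) t t' U) (2 * nh) 0 ψ) (hψ1 : star ψ ⬝ᵥ ψ = 1) :
    C.bound (m + 1) nh ≤ ∑ i, lam i * avgPairCorr (m + 1) (r i) ψ := by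
  simp only [avgPairCorr_eq_re_expect_pairCorrOp]
  exact C.bound_le hL hInj hn hu hGS hψ1

/-- **Rate of the density term**: with `ν = (1 − δ)/2` (`δ ≤ 1`),
`|bound L (pairNumber δ L) − q| ≤ |Σ_σ μ_σ| / L²` for every `L ≥ 1`. [folklore] -/
theorem abs_bound_sub_q_le (C : PairListCertTT' t t' U n lam r) {δ : ℝ} (hδ : δ ≤ 1)
    (hν : C.ν = (1 - δ) / 2) {L : ℕ} (hL : 1 ≤ L) :
    |C.bound L (pairNumber δ L) - C.q| ≤ |∑ σ : Fin 2, C.μ σ| / (L : ℝ) ^ 2 := by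
  have hL1 : (1 : ℝ) ≤ L := by exact_mod_cast hL
  have hL2 : (0 : ℝ) < (L : ℝ) ^ 2 := by positivity
  obtain ⟨hgt, hle⟩ := two_mul_pairNumber_bounds hδ L
  have hy : |(pairNumber δ L : ℝ) - C.ν * (L : ℝ) ^ 2| ≤ 1 := by
    rw [hν, abs_le]; constructor <;> linarith
  have key : C.bound L (pairNumber δ L) - C.q =
      (∑ σ : Fin 2, C.μ σ) * (((pairNumber δ L : ℝ) - C.ν * (L : ℝ) ^ 2) / (L : ℝ) ^ 2) := by
    unfold bound
    rw [sub_div, mul_div_cancel_right₀ _ hL2.ne']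
    ring
  rw [key, abs_mul, abs_div, abs_of_pos hL2]
  calc |∑ σ : Fin 2, C.μ σ| * (|(pairNumber δ L : ℝ) - C.ν * (L : ℝ) ^ 2| / (L : ℝ) ^ 2)
      ≤ |∑ σ : Fin 2, C.μ σ| * (1 / (L : ℝ) ^ 2) := by gcongr
    _ = |∑ σ : Fin 2, C.μ σ| / (L : ℝ) ^ 2 := by ring

/-- **Eventually above any `b < q`.** [folklore] -/
theorem bound_ge_eventually (C : PairListCertTT' t t' U n lam r) {δ : ℝ} (hδ : δ ≤ 1)
    (hν : C.ν = (1 - δ) / 2) {b : ℝ} (hb : b < C.q) :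
    ∃ L₀ : ℕ, ∀ L : ℕ, L₀ ≤ L → b ≤ C.bound L (pairNumber δ L) := by
  obtain ⟨L₀, hL₀⟩ := exists_forall_div_sq_lt' |∑ σ : Fin 2, C.μ σ| (sub_pos.2 hb)
  refine ⟨max 1 L₀, fun L hL => ?_⟩
  obtain ⟨hL1, hL0⟩ := max_le_iff.1 hL
  have h := (abs_le.1 (C.abs_bound_sub_q_le hδ hν hL1)).1
  have hlt := hL₀ L hL0
  linarith

end PairListCertTT'

/-- **The single-site member in list form is the single-row member**: a `PairWindowCertTT' t t' U 0 (-1)`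
(upper certificate for the local pair density) IS a list certificate for the list `[(1, 0)]`
representing the block `S = {0}` — so CEIL-1 needs no new producer format. [folklore] -/
def PairListCertTT'.ofSingle {t t' U : ℝ} (C : PairWindowCertTT' t t' U 0 (-1)) :
    PairListCertTT' t t' U 1 (fun _ => -1) (fun _ => 0) where
  Λ := C.Λ
  Λ' := C.Λ'
  hΛ := C.hΛ
  h8 := C.h8
  h0 := C.h0
  hz := C.hz
  hp0 := C.hp0
  hpr := fun _ => C.hpr
  κ := C.κ
  κ_nonneg := C.κ_nonneg
  u := C.u
  μ := C.μ
  ν := C.ν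
  m := C.m
  Λm := C.Λm
  hΛm := C.hΛm
  O := C.O
  k₁ := C.k₁
  B := C.B
  k₂ := C.k₂
  wv := C.wv
  hsh := C.hsh
  Y := C.Y
  k₃ := C.k₃
  b := C.b
  cw := C.cw
  hcw := C.hcw
  k₄ := C.k₄
  dc := C.dc
  V := C.V
  k₅ := C.k₅
  a := C.a
  word := C.word
  c := C.c
  hcert := by
    rw [Fin.sum_univ_one]
    exact C.hcert

end

end Summit.HubbardSuperconductivity.HubbardLadder
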